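import Summits.MatrixMultiplication.MatrixMultiplication.Theses.CharacteristicContinuity
import Literature.Computability.AlgebraicComplexity.GroupAlgebraTensor
import Literature.Computability.AlgebraicComplexity.MatrixMultiplicationExponentInf

/-!
# Crux `LargeCharacteristicFast` (stmt-MatrixMultiplication-18040) — `Lines/birth.lean`, the BC3 birth skeleton

Route `CharacteristicContinuity` (route-MatrixMultiplication-CharacteristicContinuity; deciding theorem
`closes : LargeCharacteristicFast → ContinuityAtZero → MatrixMultiplication`, proved in the route file).
The crux (W, "fast in large characteristic", `limsup_p ω(F̄_p) = 2`):

  `LargeCharacteristicFast : ∀ ε > 0, ∃ p₀, ∀ p prime, p₀ ≤ p → ω(F̄_p) ≤ 2 + ε`,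
  `F̄_p = AlgebraicClosure (ZMod p)`.

## The line: the Steinberg block of `F̄_p[GL_n(𝔽_p)]` + a characteristic-`p` Cohn–Umans bound

The route header's own TWO-LAYER PLAN for this crux, kernel-checked.  Write `G = GL_n(𝔽_p)`,
`N = C(n,2) = n(n-1)/2`, so `|G| = p^N ∏_{i=1}^n (p^i - 1) < p^{n²}`.  In DEFINING characteristic the
Steinberg module `St` of `G` is simple AND projective of dimension `p^N` (Steinberg 1957; Humphreys 2005,
Ch. 9; Craven 2019, §9.1): a block of defect zero, whose block ideal is the full matrix algebra
`M_{p^N}(F̄_p)`, a two-sided direct FACTOR of the (non-semisimple) algebra `F̄_p[G]`.  Hence the matrix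
multiplication tensor `⟨p^N, p^N, p^N⟩` (= the structure tensor of `M_{p^N}`) is a restriction of the
structure tensor of `F̄_p[G]` (= `groupTensor F̄_p G`), and rank is monotone under restriction:

* `stub_steinbergBlock` — `R_{F̄_p}(⟨p^N,p^N,p^N⟩) ≤ R(F̄_p[GL_n(𝔽_p)])` for all `n ≥ 2` and all primes
  `p` (TRUE; size L in Lean: the Steinberg module / defect-zero block is not in Mathlib; the tensor side —
  structure tensors, `structureTensor_restrictsTo_of_algEquiv`, `structureTensor_blockBasis_eq_matMulDirectSum`,
  `TensorRestrictsTo.tensorRank_le` — is in the tree, `GroupAlgebraTensor.lean`).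
* `stub_modularGroupAlgebraRank` — the ENGINE, OPEN: a characteristic-`p` Cohn–Umans bound for this one
  family, `R(F̄_p[GL_n(𝔽_p)]) ≤ C_n · p^{n²+n} = C_n · |G|^{1+1/n+o(1)}` for every fixed `n ≥ 2`, uniformly
  in `p` (over `ℂ` the analogue `R(ℂ[G]) ≤ ∑ d_i^ω` is Cohn–Umans 2003 Thm. 4.1 / CKSU 2005 Thm. 1.8; in
  characteristic `p ∣ |G|` no such bound is known, and the non-defect-zero blocks are not matrix algebras).
* `LargeCharacteristicFast_of : <stub₁-sig> → <stub₂-sig> → LargeCharacteristicFast` — THE skeleton theorem,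
  sorry-free: given `ε`, take the Lie rank `n = k + 2` with `k ε ≥ 6` and `p₀ = ⌈max C_n 1⌉`; for a prime
  `p ≥ p₀`, `R(⟨p^N,p^N,p^N⟩) ≤ R(F̄_p[G]) ≤ C_n p^{n²+n} ≤ p^{n²+n+1} ≤ (p^N)^{2+ε}` because
  `n² + n + 1 ≤ N(2+ε) ⟺ 2n + 1 ≤ N ε` (true once `(n-1)ε ≥ 6`), and `ω(F̄_p) ≤ log_{p^N} R(⟨p^N,p^N,p^N⟩)`
  (`advxxz2025_omega_le_logb_of_tensorRank_le`, Bläser 2013 Thm. 5.9, in tree) gives `ω(F̄_p) ≤ 2 + ε`.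
  I.e. the line yields `ω(F̄_p) ≤ 2(n+1)/(n-1) + log C_n / (N log p)` for every `n`, hence the crux.

Honest status.  Stub 1 is a theorem of modular representation theory (provable, laborious); stub 2 is open
and carries all the difficulty — for `n → ∞` it is the crux transported into ONE explicit family of modular
group algebras with an explicit rate, strictly stronger than the crux (uniform in `p`, no `p₀`; fixed rate
`|G|^{1+1/n}`), and its complex analogue for all `n` would already give `ω(ℂ) = 2` (the Steinberg CHARACTER
has degree `q^N` over `ℂ` too) — the characteristic-`p` point is that here the matrix block of dimension
exponent `→ 1/2` sits in the group algebra natively, with no lifting.  Neither stub is cheaply the crux or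
the summit (BC3 probes, `Lines/birth.md`).
Disproof used: none exists (`ledger crux ls stmt-MatrixMultiplication-18040`: no `Disproof.lean`, no
`Negative/`; `ledger negatives --problem MatrixMultiplication` = 11 refuted statements (2026-08-17), all about
TPP/STPP designs, module-rank growth or flattenings over `ℂ` — none about `ω(F̄_p)`, ranks of modular group
algebras or the Steinberg block), so no `_false_without_` obligation applies and no stub is an instance of a
landed `Negative/` lemma.
-/

-- `Summit.<Summit>.<Problem>`: for the single-conjunct summit the duplicate component is mandated.
set_option linter.dupNamespace false

noncomputable section

namespace Summit.MatrixMultiplication.MatrixMultiplication.Cruxes.LargeCharacteristicFast.Birth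

open scoped BigOperators
open Literature.Computability.AlgebraicComplexity

/-! ## The two registered stubs -/

/-- **Stub 1 — the Steinberg block (defect zero) of `F̄_p[GL_n(𝔽_p)]`**: for every `n ≥ 2` and every
prime `p`, with `N = C(n,2)`, the matrix multiplication tensor `⟨p^N, p^N, p^N⟩` over `F̄_p` has rank at
most the rank of the structure tensor of the group algebra `F̄_p[GL_n(𝔽_p)]` (in its group basis).
Why true: in defining characteristic the Steinberg module is simple and projective of dimension `p^N`, so
`F̄_p[GL_n(𝔽_p)] ≅ M_{p^N}(F̄_p) × B` as `F̄_p`-algebras (block of defect zero); the structure tensor of a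
product restricts to that of each factor, that of `M_{p^N}` in the matrix-unit basis is `⟨p^N,p^N,p^N⟩`
(`structureTensor_blockBasis_eq_matMulDirectSum` with one block), isomorphic algebras / different bases give
restriction-equivalent tensors (`structureTensor_restrictsTo_of_algEquiv`), and `R` is restriction-monotone
(`TensorRestrictsTo.tensorRank_le`).  Size L (the Steinberg module is not in Mathlib).
Sources: Humphreys2005 (Ch. 9), Craven2019 (§9.1), CohnUmans2003 (Thm. 2.3, (4.1)),
BurgisserClausenShokrollahi1997 (Def. 14.17, Rem. 14.28, Prop. 14.29). -/
theorem stub_steinbergBlock :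
    ∀ (n : ℕ), 2 ≤ n → ∀ (p : ℕ) [Fact p.Prime],
      Literature.Computability.AlgebraicComplexity.tensorRank
          (Literature.Computability.AlgebraicComplexity.matMulTensor (AlgebraicClosure (ZMod p))
            (p ^ n.choose 2) (p ^ n.choose 2) (p ^ n.choose 2)) ≤
        Literature.Computability.AlgebraicComplexity.tensorRank
          (Literature.Computability.AlgebraicComplexity.groupTensor (AlgebraicClosure (ZMod p))
            (GL (Fin n) (ZMod p))) := by
  sorry

/-- **Stub 2 — the characteristic-`p` Cohn–Umans bound for `GL_n(𝔽_p)`** (the engine, OPEN): for every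
`n ≥ 2` there is a constant `C = C_n` such that for every prime `p` the structure tensor of the modular
group algebra `F̄_p[GL_n(𝔽_p)]` has rank at most `C · p^{n²+n}` (`= C · |GL_n(𝔽_p)|^{1+1/n+o(1)}`; the
Steinberg block alone forces `≥ R(⟨p^N,p^N,p^N⟩) ≥ p^{2N} = p^{n²-n}`).  Why it might fail: every known
upper bound for `R(K[G])` with `char K ∣ |G|` loses to the radical (the non-defect-zero blocks of
`F̄_p[GL_n(𝔽_p)]` are wild for `n ≥ 3`), and already the complex analogue for all `n` would give
`ω(ℂ) = 2`; why it is the right target: it is ONE explicit family, uniform in `p`, with the rate the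
assembly needs and nothing more (`p^{n²+n}`, not `p^{n²-n+o(1)}`).  Size XL / open-problem.
Sources: CohnUmans2003 (Thm. 4.1), CohnKleinbergSzegedyUmans2005 (Thm. 1.8), Craven2019 (§9.1),
Humphreys2005 (Ch. 9), Blaser2013 (§10). -/
theorem stub_modularGroupAlgebraRank :
    ∀ (n : ℕ), 2 ≤ n → ∃ C : ℝ, ∀ (p : ℕ) [Fact p.Prime],
      (Literature.Computability.AlgebraicComplexity.tensorRank
          (Literature.Computability.AlgebraicComplexity.groupTensor (AlgebraicClosure (ZMod p))
            (GL (Fin n) (ZMod p))) : ℝ) ≤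
        C * (p : ℝ) ^ (n ^ 2 + n) := by
  sorry

/-! ## Sorry-free core -/

/-- **Exponent extraction**: `R(⟨m,m,m⟩) ≤ r ≤ m^t` with `m ≥ 2` gives `ω(K) ≤ t` — `ω ≤ log_m r`
(ADVXXZ 2025 §3.4 / Bläser 2013 Thm. 5.9, in tree as `advxxz2025_omega_le_logb_of_tensorRank_le`) and
`log_m r ≤ t ⟺ r ≤ m^t` (`r > 0` because `R(⟨m,m,m⟩) ≥ m² > 0`). [folklore] -/
theorem omega_le_of_tensorRank_le_rpow (K : Type) [Field K] {m r : ℕ} (hm : 2 ≤ m) {t : ℝ}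
    (hR : tensorRank (matMulTensor K m m m) ≤ r) (hr : (r : ℝ) ≤ (m : ℝ) ^ t) : omega K ≤ t := by
  have hm1 : (1 : ℝ) < m := by exact_mod_cast lt_of_lt_of_le one_lt_two hm
  have hr0 : (0 : ℝ) < r :=
    lt_of_lt_of_le (tensorRank_matMulTensor_pos K hm) (by exact_mod_cast hR)
  exact (advxxz2025_omega_le_logb_of_tensorRank_le K hm hR).trans
    ((Real.logb_le_iff_le_rpow hm1 hr0).2 hr)

/-- **Rate bookkeeping**: with `k ε ≥ 6` and `n = k + 2`, `N = C(n,2)`, one has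
`n² + n + 1 ≤ N (2 + ε)` (i.e. `2n + 1 ≤ N ε`). [folklore] -/
theorem exponent_le {k : ℕ} {ε : ℝ} (hε : 0 < ε) (hkε : 6 ≤ (k : ℝ) * ε) :
    (((k + 2) ^ 2 + (k + 2) + 1 : ℕ) : ℝ) ≤ (((k + 2).choose 2 : ℕ) : ℝ) * (2 + ε) := by
  rw [Nat.cast_choose_two]
  push_cast
  have h6k : (k : ℝ) * 6 ≤ (k : ℝ) * ((k : ℝ) * ε) :=
    mul_le_mul_of_nonneg_left hkε (Nat.cast_nonneg k)
  nlinarith [hkε, hε.le, h6k, (Nat.cast_nonneg k : (0 : ℝ) ≤ k)]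

/-! ## The composition: the two stub statements prove the crux BY NAME -/

/-- **THE SKELETON THEOREM.** The crux
`Summit.MatrixMultiplication.MatrixMultiplication.Theses.CharacteristicContinuity.LargeCharacteristicFast`
(stmt-MatrixMultiplication-18040) from the two stub STATEMENTS as hypotheses: given `ε > 0` take
`n = k + 2` with `k ε ≥ 6`, the constant `C = C_n` of stub 2 and `p₀ = ⌈max C 1⌉`; for a prime `p ≥ p₀`,
`R(⟨p^N,p^N,p^N⟩) ≤ R(F̄_p[GL_n(𝔽_p)]) ≤ C p^{n²+n} ≤ p · p^{n²+n} ≤ (p^N)^{2+ε}`, so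
`ω(F̄_p) ≤ 2 + ε` by exponent extraction.  Sorry-free; standard axioms. [folklore] -/
theorem LargeCharacteristicFast_of :
    (∀ (n : ℕ), 2 ≤ n → ∀ (p : ℕ) [Fact p.Prime],
      Literature.Computability.AlgebraicComplexity.tensorRank
          (Literature.Computability.AlgebraicComplexity.matMulTensor (AlgebraicClosure (ZMod p))
            (p ^ n.choose 2) (p ^ n.choose 2) (p ^ n.choose 2)) ≤
        Literature.Computability.AlgebraicComplexity.tensorRank
          (Literature.Computability.AlgebraicComplexity.groupTensor (AlgebraicClosure (ZMod p))
            (GL (Fin n) (ZMod p)))) →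
    (∀ (n : ℕ), 2 ≤ n → ∃ C : ℝ, ∀ (p : ℕ) [Fact p.Prime],
      (Literature.Computability.AlgebraicComplexity.tensorRank
          (Literature.Computability.AlgebraicComplexity.groupTensor (AlgebraicClosure (ZMod p))
            (GL (Fin n) (ZMod p))) : ℝ) ≤
        C * (p : ℝ) ^ (n ^ 2 + n)) →
    Summit.MatrixMultiplication.MatrixMultiplication.Theses.CharacteristicContinuity.LargeCharacteristicFast := by
  intro hSt hGA ε hε
  -- (1) the Lie rank `n = k + 2`, with `k ε ≥ 6`
  obtain ⟨k, hk⟩ := exists_nat_ge (6 / ε)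
  have hkε : 6 ≤ (k : ℝ) * ε := by rwa [div_le_iff₀ hε] at hk
  have hn2 : 2 ≤ k + 2 := by omega
  -- (2) the characteristic-p Cohn–Umans constant at this rank; threshold `p₀ = ⌈max C 1⌉`
  obtain ⟨C, hC⟩ := hGA (k + 2) hn2
  refine ⟨⌈max C 1⌉₊, fun p hpFact hp => ?_⟩
  have hP : p.Prime := hpFact.out
  have hp1r : (1 : ℝ) ≤ p := by exact_mod_cast hP.one_lt.le
  have hp0r : (0 : ℝ) ≤ p := by positivity
  have hC₁p : max C 1 ≤ (p : ℝ) := (Nat.le_ceil (max C 1)).trans (by exact_mod_cast hp)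
  -- (3) the Steinberg dimension `p ^ N`, `N = C(k+2, 2) ≥ 1`, is at least `2`
  have hN1 : 1 ≤ (k + 2).choose 2 := Nat.choose_pos hn2
  have hm2 : 2 ≤ p ^ (k + 2).choose 2 := hP.two_le.trans (Nat.le_self_pow (by omega) p)
  -- (4) the rank bound `R(F̄_p[GL_{k+2}(𝔽_p)]) ≤ (p^N)^(2+ε)`
  have hbound :
      (tensorRank (groupTensor (AlgebraicClosure (ZMod p)) (GL (Fin (k + 2)) (ZMod p))) : ℝ) ≤
        ((p ^ (k + 2).choose 2 : ℕ) : ℝ) ^ (2 + ε) := by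
    calc (tensorRank (groupTensor (AlgebraicClosure (ZMod p)) (GL (Fin (k + 2)) (ZMod p))) : ℝ)
        ≤ C * (p : ℝ) ^ ((k + 2) ^ 2 + (k + 2)) := hC p
      _ ≤ max C 1 * (p : ℝ) ^ ((k + 2) ^ 2 + (k + 2)) :=
          mul_le_mul_of_nonneg_right (le_max_left C 1) (by positivity)
      _ ≤ (p : ℝ) * (p : ℝ) ^ ((k + 2) ^ 2 + (k + 2)) :=
          mul_le_mul_of_nonneg_right hC₁p (by positivity)
      _ = (p : ℝ) ^ ((((k + 2) ^ 2 + (k + 2) + 1 : ℕ)) : ℝ) := by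
          rw [Real.rpow_natCast]; ring
      _ ≤ (p : ℝ) ^ ((((k + 2).choose 2 : ℕ) : ℝ) * (2 + ε)) :=
          Real.rpow_le_rpow_of_exponent_le hp1r (exponent_le hε hkε)
      _ = ((p ^ (k + 2).choose 2 : ℕ) : ℝ) ^ (2 + ε) := by
          rw [Real.rpow_mul hp0r, Real.rpow_natCast, Nat.cast_pow]
  -- (5) exponent extraction through the Steinberg block
  exact omega_le_of_tensorRank_le_rpow (AlgebraicClosure (ZMod p)) hm2 (hSt (k + 2) hn2 p) hbound

/-- The crux fed with the two DECLARED stubs (closed only through their `sorry`s; the shape the line's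
provers discharge stub by stub). [folklore] -/
theorem LargeCharacteristicFast_of_stubs :
    Summit.MatrixMultiplication.MatrixMultiplication.Theses.CharacteristicContinuity.LargeCharacteristicFast :=
  LargeCharacteristicFast_of stub_steinbergBlock stub_modularGroupAlgebraRank

end Summit.MatrixMultiplication.MatrixMultiplication.Cruxes.LargeCharacteristicFast.Birth

end
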